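import Summits.ValiantsHypothesis.ValiantsHypothesis.Theorems.BarrierLeverTorusIsolatedDeterminantsHitByVP

/-!
# Route BarrierLever — torus isolation, part 2: the Chow side, certificates and limits of the
# method, and the reductions of items 20152 / 20239 to torus-balanced layouts

Continuation of `…TorusIsolatedDeterminantsHitByVP.lean` (helper file `--supports` item
stmt-ValiantsHypothesis-20152 `ReadOnceDeterminantsHitByVP`; also bears on stmt-ValiantsHypothesis-20239
`ChowHitsReadOnceDeterminants`).

* **Cor. D (Chow side, `chowHits_torusIsolated`).** For every torus-isolated constant-free layout `β`
  the product of the `n` affine forms `1 + Σ t_i x_i` has `det[coeff_{β(i,j)}] ≠ 0`: item 20239's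
  conclusion holds for all torus-isolated `β` (injectivity not needed).
* **Certificates and limits.** `torusIsolated_of_rowDominant`: if every diagonal entry is a variable
  that is strictly heaviest in its row for some additive weight `φ : ℕ^n → ℕ`, the layout is
  torus-isolated. `permWeight_eq_of_additive` / `not_torusIsolated_of_additive`: a HANKEL-TYPE layout
  `wt(E i j) = u_i + w_j` (Nisan partition matrices, catalecticants, Raz's partial-derivative
  matrices) of size `r ≥ 2` is never torus-isolated — those are exactly the layouts the tree hits by
  rank methods instead (`stub_catalecticantDeterminant`, `stub_partitionDeterminantHit`,
  `isSuccinctHittingSet_razDeterminants`).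
* **Reductions.** `item20152_iff_balanced` / `item20239_iff_balanced`: the signatures of
  stmt-ValiantsHypothesis-20152 / -20239 (verbatim, left) are equivalent to the same statements
  restricted to torus-BALANCED layouts (right): the open residue of both items is the Hankel-type /
  balanced class, where the witness must come from rank arguments, not from monomial isolation.

Lean text authored by the cell planner seat `valiant-natproofs-p1` (gen 6, HOME/p1/TorusIsolation-
g6.lean, referee REF-G12/REF-G13 PASS), ported by the prover seat.

WHAT THIS IS NOT: neither item 20152 nor 20239 is proved here (only reduced); nothing on FSV
Question 6 / crux stmt-14610 or `VP` vs `VNP`.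

References: [ForbesShpilkaVolk2018] §8; Klivans–Spielman 2001; [Burgisser2000] §2.1.
-/

-- layout Summits/ValiantsHypothesis/ValiantsHypothesis forces the duplicated namespace component
set_option linter.dupNamespace false

namespace Summit.ValiantsHypothesis.ValiantsHypothesis.Theorems.BarrierLever.TorusIsolation

open MvPolynomial Literature.Barriers.ValiantsHypothesis Literature.Computability.AlgebraicComplexity
open Summit.ValiantsHypothesis.ValiantsHypothesis.Theorems.BarrierLever.SuccinctHittingSetsForVP

noncomputable section

variable {n r : ℕ}

/-! ## 7. The Chow side (item 20239 `ChowHitsReadOnceDeterminants`) -/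

/-- An affine form `1 + Σ tᵢ xᵢ` has degree `≤ 1`. -/
theorem totalDegree_affineForm_le (t : Fin n → ℂ) :
    (1 + ∑ i : Fin n, C (t i) * X i : MvPolynomial (Fin n) ℂ).totalDegree ≤ 1 := by
  refine (totalDegree_add _ _).trans (max_le (by simp) ?_)
  refine (totalDegree_finsetSum _ _).trans (Finset.sup_le fun i _ => ?_)
  calc (C (t i) * X i : MvPolynomial (Fin n) ℂ).totalDegree
      ≤ (C (t i) : MvPolynomial (Fin n) ℂ).totalDegree + (X i : MvPolynomial (Fin n) ℂ).totalDegree :=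
        totalDegree_mul _ _
    _ ≤ 0 + 1 := add_le_add (by simp) (totalDegree_X (R := ℂ) i).le
    _ = 1 := rfl

/-- **Cor. D.** Every torus-isolated constant-free layout `β` (any size, injective or not) is hit
by a product of `n` affine forms, i.e. by the Chow cone `Chow_n`. -/
theorem chowHits_torusIsolated (β : Fin r × Fin r → degLEMonomials n)
    (hβ : Layout.TorusIsolated (Matrix.of fun i j => (Sum.inl (β (i, j)) : (degLEMonomials n) ⊕ ℂ))) :
    ∃ ℓ : Fin n → MvPolynomial (Fin n) ℂ, (∀ i, (ℓ i).totalDegree ≤ 1) ∧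
      (Matrix.of fun i j : Fin r =>
        coeff ((β (i, j) : degLEMonomials n) : Fin n →₀ ℕ) (∏ k, ℓ k)).det ≠ 0 := by
  set E : Layout n r := Matrix.of fun i j => (Sum.inl (β (i, j)) : (degLEMonomials n) ⊕ ℂ) with hEdef
  obtain ⟨t, ht⟩ := Layout.exists_torusScale_hits (linPow n) E
    (Layout.isolatedAt_of_torusIsolated _ linPow_fullSupport E hβ)
  refine ⟨fun _ => 1 + ∑ i : Fin n, C (t i) * X i, fun _ => totalDegree_affineForm_le t, ?_⟩
  rw [← torusScale_linPow_eq_prod]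
  have hM : E.map (Sum.elim (coeffVector (degLEMonomials n) (torusScale t (linPow n))) (id : ℂ → ℂ))
      = Matrix.of fun i j : Fin r =>
          coeff ((β (i, j) : degLEMonomials n) : Fin n →₀ ℕ) (torusScale t (linPow n)) := by
    ext i j
    simp [hEdef]
  rwa [Layout.eval_detPoly, hM] at ht

/-! ## 8. Certificates and limits of the method -/

namespace Layout

/-- **Row-dominance certificate.** If the diagonal constants are nonzero and, for some additive
weight `φ`, each diagonal entry is strictly `φ`-heavier than every other entry of its row, then the
identity permutation is isolated: the layout is torus-isolated. -/
theorem torusIsolated_of_rowDominant (E : Layout n r) (φ : (Fin n →₀ ℕ) →+ ℕ)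
    (hdiag : ∀ i, E.const i i ≠ 0)
    (hdom : ∀ i j, j ≠ i → φ (E.weight i j) < φ (E.weight i i)) : E.TorusIsolated := by
  classical
  refine ⟨1, ?_, fun σ hσ _ hw => ?_⟩
  · simpa [permConst] using Finset.prod_ne_zero_iff.mpr fun i _ => hdiag i
  · have hφ := congrArg φ hw
    simp only [permWeight, map_sum, Equiv.Perm.coe_one, id_eq] at hφ
    -- reindex the left sum by rows: `i ↦ σ i`
    have hre : ∑ i, φ (E.weight (σ i) i) = ∑ j, φ (E.weight j (σ.symm j)) := by
      rw [← Equiv.sum_comp σ (fun j => φ (E.weight j (σ.symm j)))]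
      simp
    rw [hre] at hφ
    have hlt : ∑ j, φ (E.weight j (σ.symm j)) < ∑ j, φ (E.weight j j) := by
      obtain ⟨j₀, hj₀⟩ : ∃ j, σ.symm j ≠ j := by
        by_contra hall
        push Not at hall
        apply hσ
        exact Equiv.ext fun j => by simpa using (congrArg σ (hall j)).symm
      exact Finset.sum_lt_sum (fun j _ => by
          by_cases h : σ.symm j = j
          · rw [h]
          · exact (hdom j _ h).le)
        ⟨j₀, Finset.mem_univ _, hdom j₀ _ hj₀⟩
    exact absurd hφ (ne_of_lt hlt)

/-- **Hankel-type layouts are torus-balanced**: if `wt(E i j) = u_i + w_j` then every permutation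
has the same exponent-sum vector. -/
theorem permWeight_eq_of_additive (E : Layout n r) (u w : Fin r → Fin n →₀ ℕ)
    (h : ∀ i j, E.weight i j = u i + w j) (σ : Equiv.Perm (Fin r)) :
    E.permWeight σ = ∑ i, u i + ∑ i, w i := by
  simp only [permWeight, h, Finset.sum_add_distrib]
  rw [Equiv.sum_comp σ u]

/-- Hence a constant-free Hankel-type layout of size `r ≥ 2` is never torus-isolated (the honest
limit of the method: Nisan / catalecticant / Raz partial-derivative layouts need rank arguments). -/
theorem not_torusIsolated_of_additive (hr : 2 ≤ r) (E : Layout n r) (u w : Fin r → Fin n →₀ ℕ)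
    (h : ∀ i j, E.weight i j = u i + w j) (hvar : ∀ i j, E.const i j ≠ 0) :
    ¬ E.TorusIsolated := by
  rintro ⟨σ₀, _, hiso⟩
  have h0 : (0 : ℕ) < r := by omega
  have h1 : (1 : ℕ) < r := by omega
  set a : Fin r := ⟨0, h0⟩
  set b : Fin r := ⟨1, h1⟩
  have hab : a ≠ b := by simp [a, b, Fin.ext_iff]
  have hne : σ₀ * Equiv.swap a b ≠ σ₀ := by
    intro heq
    have : Equiv.swap a b = 1 := mul_left_cancel (heq.trans (mul_one σ₀).symm)
    exact hab (Equiv.swap_eq_one_iff.mp this)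
  refine hiso _ hne ?_ ?_
  · exact Finset.prod_ne_zero_iff.mpr fun i _ => hvar _ _
  · rw [permWeight_eq_of_additive E u w h, permWeight_eq_of_additive E u w h]

end Layout

/-! ## 9. Item signatures (verbatim) and the reductions

The left sides of `item20152_iff_balanced` / `item20239_iff_balanced` are verbatim copies of the
signatures of `stmt-ValiantsHypothesis-20152` / `-20239` (copied rather than imported from the route
file, which imports closing Theorems files); the right sides are the same statements restricted to
torus-BALANCED layouts — the kernel-checked reductions. -/

/-- Inline (built-decls-only) form of `Layout.TorusIsolated E`, as it appears in the filed item. -/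
def InlineIsolated {n r : ℕ} (E : Matrix (Fin r) (Fin r) ((degLEMonomials n) ⊕ ℂ)) : Prop :=
  ∃ σ₀ : Equiv.Perm (Fin r), (∏ i, Sum.elim (fun _ => (1 : ℂ)) id (E (σ₀ i) i)) ≠ 0 ∧
    ∀ σ : Equiv.Perm (Fin r), σ ≠ σ₀ → (∏ i, Sum.elim (fun _ => (1 : ℂ)) id (E (σ i) i)) ≠ 0 →
      (∑ i, Sum.elim (fun m : degLEMonomials n => (m : Fin n →₀ ℕ)) (fun _ => (0 : Fin n →₀ ℕ))
          (E (σ i) i)) ≠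
        (∑ i, Sum.elim (fun m : degLEMonomials n => (m : Fin n →₀ ℕ)) (fun _ => (0 : Fin n →₀ ℕ))
          (E (σ₀ i) i))

/-- The inlined isolation condition is `Layout.TorusIsolated` (definitionally). -/
theorem inlineIsolated_iff {n r : ℕ} (E : Layout n r) : InlineIsolated E ↔ E.TorusIsolated := Iff.rfl

/-- **Reduction for item 20152** (left side = the signature of stmt-ValiantsHypothesis-20152
`ReadOnceDeterminantsHitByVP` verbatim; right side = the same restricted to torus-BALANCED layouts,
`¬ InlineIsolated E`): read-once determinants are succinctly hit by `VP` iff the torus-balanced ones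
are. -/
theorem item20152_iff_balanced :
    (∀ a : ℕ, ∃ b n₀ : ℕ, ∀ n : ℕ, n₀ ≤ n →
      IsSuccinctHittingSet (degLEMonomials n) (SmallCircuits ℂ n b)
      {D | ∃ (r : ℕ) (E : Matrix (Fin r) (Fin r) (↥(degLEMonomials n) ⊕ ℂ)),
      r ≤ (Nat.choose (2 * n) n) ^ a ∧
      (∀ p q : Fin r × Fin r, ∀ m, E p.1 p.2 = Sum.inl m → E q.1 q.2 = Sum.inl m → p = q) ∧
      D = (E.map (Sum.elim MvPolynomial.X MvPolynomial.C)).det}) ↔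
    (∀ a : ℕ, ∃ b n₀ : ℕ, ∀ n : ℕ, n₀ ≤ n →
      IsSuccinctHittingSet (degLEMonomials n) (SmallCircuits ℂ n b)
      {D | ∃ (r : ℕ) (E : Matrix (Fin r) (Fin r) (↥(degLEMonomials n) ⊕ ℂ)),
      r ≤ (Nat.choose (2 * n) n) ^ a ∧
      (∀ p q : Fin r × Fin r, ∀ m, E p.1 p.2 = Sum.inl m → E q.1 q.2 = Sum.inl m → p = q) ∧
      ¬ InlineIsolated E ∧
      D = (E.map (Sum.elim MvPolynomial.X MvPolynomial.C)).det}) := by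
  constructor
  · intro h a
    obtain ⟨b, n₀, hb⟩ := h a
    refine ⟨b, n₀, fun n hn => (hb n hn).mono le_rfl ?_⟩
    rintro D ⟨r, E, hr, hro, -, hD⟩
    exact ⟨r, E, hr, hro, hD⟩
  · intro h a
    obtain ⟨b, n₀, hb⟩ := h a
    refine ⟨max b 3, max n₀ 3, fun n hn => ?_⟩
    have hn₀ : n₀ ≤ n := le_trans (le_max_left _ _) hn
    have hn3 : 3 ≤ n := le_trans (le_max_right _ _) hn
    rintro D ⟨r, E, hr, hro, rfl⟩ hD0
    by_cases hiso : InlineIsolated E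
    · obtain ⟨f, hf, hne⟩ := isSuccinctHittingSet_torusIsolated hn3 _
        ⟨r, E, (inlineIsolated_iff E).mp hiso, rfl⟩ hD0
      exact ⟨f, smallCircuits_mono ℂ (le_max_right b 3) (by omega) hf, hne⟩
    · obtain ⟨f, hf, hne⟩ := hb n hn₀ _ ⟨r, E, hr, hro, hiso, rfl⟩ hD0
      exact ⟨f, smallCircuits_mono ℂ (le_max_left b 3) (by omega) hf, hne⟩

/-- Constant-free isolation: some permutation's exponent sum is attained by no other permutation. -/
def BetaIsolated {n r : ℕ} (β : Fin r × Fin r → ↥(degLEMonomials n)) : Prop :=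
  ∃ σ₀ : Equiv.Perm (Fin r), ∀ σ : Equiv.Perm (Fin r), σ ≠ σ₀ →
    (∑ i, ((β (σ i, i) : ↥(degLEMonomials n)) : Fin n →₀ ℕ)) ≠
      (∑ i, ((β (σ₀ i, i) : ↥(degLEMonomials n)) : Fin n →₀ ℕ))

/-- Constant-free isolation implies torus isolation of the constant-free layout. -/
theorem torusIsolated_of_betaIsolated {n r : ℕ} (β : Fin r × Fin r → ↥(degLEMonomials n))
    (h : BetaIsolated β) :
    Layout.TorusIsolated (Matrix.of fun i j => (Sum.inl (β (i, j)) : (degLEMonomials n) ⊕ ℂ)) := by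
  obtain ⟨σ₀, hσ₀⟩ := h
  refine ⟨σ₀, ?_, fun σ hσ _ => ?_⟩
  · simp [Layout.permConst, Layout.const]
  · simpa [Layout.permWeight, Layout.weight] using hσ₀ σ hσ

/-- **Reduction for item 20239** (left side = the signature of stmt-ValiantsHypothesis-20239
`ChowHitsReadOnceDeterminants` verbatim; right side = the same restricted to torus-BALANCED
constant-free layouts, `¬ BetaIsolated β`): Chow hits all read-once layouts iff it hits the
torus-balanced ones. -/
theorem item20239_iff_balanced :
    (∃ n₀ : ℕ, ∀ n : ℕ, n₀ ≤ n → ∀ (r : ℕ) (β : Fin r × Fin r → ↥(degLEMonomials n)),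
      Function.Injective β → ∃ ℓ : Fin n → MvPolynomial (Fin n) ℂ, (∀ i, (ℓ i).totalDegree ≤ 1) ∧
      (Matrix.of fun i j : Fin r =>
      MvPolynomial.coeff ((β (i, j) : ↥(degLEMonomials n)) : Fin n →₀ ℕ) (∏ k, ℓ k)).det ≠ 0) ↔
    (∃ n₀ : ℕ, ∀ n : ℕ, n₀ ≤ n → ∀ (r : ℕ) (β : Fin r × Fin r → ↥(degLEMonomials n)),
      Function.Injective β → ¬ BetaIsolated β →
      ∃ ℓ : Fin n → MvPolynomial (Fin n) ℂ, (∀ i, (ℓ i).totalDegree ≤ 1) ∧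
      (Matrix.of fun i j : Fin r =>
      MvPolynomial.coeff ((β (i, j) : ↥(degLEMonomials n)) : Fin n →₀ ℕ) (∏ k, ℓ k)).det ≠ 0) := by
  constructor
  · rintro ⟨n₀, h⟩
    exact ⟨n₀, fun n hn r β hβ _ => h n hn r β hβ⟩
  · rintro ⟨n₀, h⟩
    refine ⟨n₀, fun n hn r β hβ => ?_⟩
    by_cases hiso : BetaIsolated β
    · exact chowHits_torusIsolated β (torusIsolated_of_betaIsolated β hiso)
    · exact h n hn r β hβ hiso

end

end Summit.ValiantsHypothesis.ValiantsHypothesis.Theorems.BarrierLever.TorusIsolation
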